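import Summits.HodgeConjecture.CorCM.Model.CMDominated
import Summits.HodgeConjecture.CorCM.Geometry.CupFacts
import Summits.HodgeConjecture.CorCM.RationalExteriorAlgebra
import HarnessLib

/-!
# COR-CM fact row N1 `cupExterior` for the model of record `Model.universeOf hHD hI hU h₃`:
# `H^{k+1}(A′, ℚ) = ⋀^{k+1} H¹(A′, ℚ)` via the cup product for the CM products `A′ = ∏_j A_{(F,Θ_j)}`

Cell `pub-hodgecm2`, seat model-2 (BINDER-OWNERS.md v1 row N1). KERNEL from the tree's RATIONAL exterior
algebra theorem for complex abelian varieties `hasExteriorCohomologyH1_rat` (cell file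
`CorCM/RationalExteriorAlgebra.lean`, p2; Mumford §1 (4), Lange–Birkenhake Lemma 1.1.17) applied to the abelian
variety `cmProdAV F h₃ n Θ` whose underlying variety is the interpretation of `U.cmProd F Θ`
(`Model.scheme_cmProd_universeOf`), with the comparison map `wedgeToCup ℚ _ (k+1)` as the witness `e`; the
package's left-bracketed iterated cup product `cupPow` agrees with the tree's right-bracketed `cupPowOne` by
associativity (`cupPowOne_eq_snoc`, `cupPowOne_succ_eq_cupPow`).
-/

noncomputable section

open CategoryTheory
open Literature.AlgebraicGeometry.Motives (bettiCohomology CMType IsSmoothProjective)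
open Literature.AlgebraicGeometry.Motives
open Literature.AlgebraicTopology.SingularHomology

namespace Summit.HodgeConjecture.CorCM

namespace Model

open Literature.NumberTheory.Automorphic
open Literature.NumberTheory.Automorphic.PicardCM
open Literature.AlgebraicGeometry.HodgeTheory
open Summit.HodgeConjecture.CorCM.Domination (cmProdAV)


/-- **Re-bracketing the iterated cup product**: `m_{d+1}(v) = m_d(init v) ⌣ v_last` (the tree's
`cupPowOne` is `v₀ ⌣ m_d(tail v)`; associativity of the cup product, Hatcher §3.2). [cite: HatcherAT2002, §3.2 p. 211] -/
theorem cupPowOne_eq_snoc {Y : Type} [TopologicalSpace Y] :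
    ∀ (d : ℕ) (v : Fin (d + 1) → singularCohomology ℚ ℚ Y 1),
      cupPowOne ℚ Y (d + 1) v = cupProduct rfl (cupPowOne ℚ Y d (Fin.init v)) (v (Fin.last d))
  | 0, v => by
      rw [cupPowOne_one, cupPowOne_zero]
      exact (one_cupProduct (v 0)).symm
  | d + 1, v => by
      rw [cupPowOne_succ, cupPowOne_eq_snoc d (Fin.tail v), cupPowOne_succ]
      have h1 : Fin.init (Fin.tail v) = Fin.tail (Fin.init v) := by
        funext i; simp [Fin.init, Fin.tail, Fin.castSucc, Fin.succ]
      have h2 : Fin.tail v (Fin.last d) = v (Fin.last (d + 1)) := rfl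
      have h3 : (Fin.init v) 0 = v 0 := rfl
      rw [h1, h2, h3]
      exact (cupProduct_assoc (Nat.add_comm 1 d) rfl rfl (Nat.add_comm 1 (d + 1)) (v 0)
        (cupPowOne ℚ Y d (Fin.tail (Fin.init v))) (v (Fin.last (d + 1)))).symm

/-- The package's left-bracketed `cupPow X k a` on `universeOf` IS the tree's `cupPowOne ℚ _ (k+1) a`.
[cite: HatcherAT2002, §3.2 p. 211] -/
theorem cupPowOne_succ_eq_cupPow (hHD : exists_isReal_hodgeModel) (hI : hodgePQ_independent_of_hodgeModel)
    (hU : BallQuotientUniformisedDatum) (h₃ : CMAbelianVarietyRealised) (X : Var) :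
    ∀ (k : ℕ) (a : Fin (k + 1) → (universeOf hHD hI hU h₃).Coh X 1),
      cupPowOne ℚ (ComplexPoints (Var.scheme hU h₃ X)) (k + 1) a = (universeOf hHD hI hU h₃).cupPow X k a
  | 0, a => cupPowOne_one ℚ _ a
  | k + 1, a =>
      (cupPowOne_eq_snoc (k + 1) a).trans
        (congrArg (fun z => cupProduct (rfl : k + 1 + 1 = k + 1 + 1) z (a (Fin.last (k + 1))))
          (cupPowOne_succ_eq_cupPow hHD hI hU h₃ X k (Fin.init a)))

/-- **N1 `Fact_cupExterior`** for `universeOf`: for the CM product `U.cmProd F Θ` (an abelian variety,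
`cmProdAV`), `v₀ ∧ ⋯ ∧ v_k ↦ v₀ ∪ ⋯ ∪ v_k` is a linear bijection `⋀^{k+1} H¹(A′, ℚ) ≅ H^{k+1}(A′, ℚ)`
(witness: the tree's `wedgeToCup ℚ`; bijectivity: `hasExteriorCohomologyH1_rat`).
[cite: MumfordAV1970, §1 (3)–(4)] [cite: LangeBirkenhake1992, Lemma 1.1.17] -/
theorem universeOf_fact_cupExterior (hHD : exists_isReal_hodgeModel) (hI : hodgePQ_independent_of_hodgeModel)
    (hU : BallQuotientUniformisedDatum) (h₃ : CMAbelianVarietyRealised)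
    : (universeOf hHD hI hU h₃).Fact_cupExterior := by
  intro F n Θ k
  have hex : HasExteriorCohomologyH1 ℚ
      (ComplexPoints (Var.scheme hU h₃ ((universeOf hHD hI hU h₃).cmProd F Θ))) := by
    rw [scheme_cmProd_universeOf hHD hI hU h₃ F n Θ]
    exact hasExteriorCohomologyH1_rat (cmProdAV F h₃ n Θ)
  exact ⟨wedgeToCup ℚ _ (k + 1), hex (k + 1), fun a ↦
    (wedgeToCup_ιMulti ℚ _ (k + 1) a).trans (cupPowOne_succ_eq_cupPow hHD hI hU h₃ _ k a)⟩

end Model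

end Summit.HodgeConjecture.CorCM

end
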